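import Summits.AtomisticToContinuum.BoseEinsteinCondensation.Theses.BlockLatticeFSum
import Summits.AtomisticToContinuum.BoseEinsteinCondensation.Theorems.BlockLatticeFSumFSumOccupation
import Summits.AtomisticToContinuum.BoseEinsteinCondensation.Theorems.BlockLatticeFSumSuperblockOcc
import Summits.AtomisticToContinuum.BoseEinsteinCondensation.Theorems.BlockLatticeFSumBessel
import Summits.AtomisticToContinuum.BoseEinsteinCondensation.Theorems.BlockLatticeFSumCovariance
import Summits.AtomisticToContinuum.BoseEinsteinCondensation.Theorems.BlockLatticeFSumShift

/-!
# `ShellBudget` BY NAME (route `BlockLatticeFSum`, support item stmt-AtomisticToContinuum-27507)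
decomp-a2c lens-6 g22.  `BlockCondensation → Σ_q ε_q·n(f_q) ≤ 6ηN` for near-ground states, `4 ∣ K`.

Proof = the route header's plan, all inputs kernel-checked helpers:
* lattice f-sum identity `Σ_q ε_q n(f_q) = Σ_j Σ_B n((u_B − u_(B+e_j))/√2)` (`FSum.fsum_occupation`);
* super-block Cauchy–Schwarz `Σ_jΣ_B n(bond) + (3/4)·Σ_c n(U_c) ≤ 6·Σ_B n(u_B)`
  (`SuperblockOcc.superblock_occupation`) and Bessel `Σ_B n(u_B) ≤ N` (`Bessel…le_card`);
* `Σ_c n(U_c) ≥ 8(1−η)N`: `BlockCondensation` at `(2A, K/2)` applied to the 8 torus translates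
  `Ψ(· + (L/K)τ₀)` (`exists_translate`, `periodicEnergy_translate`), transported back by the
  covariance of cell occupations (`Covariance.cellOccupation_translate`) and the identification of the
  shifted big blocks with the super-blocks of corner `2S + τ₀` (`Shift.*`), distinct corners.
No `sorry`, no new definitions.
-/

namespace Summit.AtomisticToContinuum.BoseEinsteinCondensation.Theses.BlockLatticeFSum.SB

open MeasureTheory Complex
open scoped ENNReal NNReal BigOperators
open Literature.MathematicalPhysics.QuantumManyBody.BoseGas

set_option maxHeartbeats 800000 in
/-- **`ShellBudget` (stmt-AtomisticToContinuum-27507) holds.** -/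
theorem shellBudget :
    Summit.AtomisticToContinuum.BoseEinsteinCondensation.Theses.BlockLatticeFSum.ShellBudget := by
  intro hBC v hv A hA η hη
  obtain ⟨ρ₀, hρ₀, N₀, H⟩ := hBC v hv (2 * A) (by positivity) η hη
  refine ⟨ρ₀, hρ₀, max N₀ 1, ?_⟩
  intro N L hL hN hNρ
  obtain ⟨δ, hδ, HΨ⟩ := H N L hL (le_trans (le_max_left _ _) hN) hNρ
  refine ⟨δ, hδ, ?_⟩
  intro Ψ hΨE K h4 hK hwin
  obtain ⟨m, hm⟩ := h4
  have hKK : K = 2 * (K / 2) := by omega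
  have hK2 : 2 ≤ K := by omega
  have hK'pos : 0 < K / 2 := by omega
  have hK'even : Even (K / 2) := ⟨m, by omega⟩
  haveI : NeZero K := ⟨by omega⟩
  have hN1 : 1 ≤ N := le_trans (le_max_right _ _) hN
  obtain ⟨n, rfl⟩ : ∃ n, N = n + 1 := ⟨N - 1, by omega⟩
  have hΨc : Continuous Ψ.ψ := Ψ.contDiff.continuous
  -- the window for the `K/2`-tiling at `2A`
  have hK'r : ((K / 2 : ℕ) : ℝ) = (K : ℝ) / 2 := by
    have h2 : ((K : ℕ) : ℝ) = ((2 * (K / 2) : ℕ) : ℝ) := by exact_mod_cast hKK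
    push_cast at h2
    linarith
  have hKr : (0 : ℝ) < (K : ℝ) := by exact_mod_cast hK
  have hLK' : L / ((K / 2 : ℕ) : ℝ) = 2 * (L / (K : ℝ)) := by
    rw [hK'r]
    field_simp
  have hwin' : 2 * A / Real.sqrt (((n + 1 : ℕ) : ℝ) / L ^ 3) ≤ L / ((K / 2 : ℕ) : ℝ)
      ∧ L / ((K / 2 : ℕ) : ℝ) ≤ 2 * (2 * A) / Real.sqrt (((n + 1 : ℕ) : ℝ) / L ^ 3) := by
    rw [hLK']
    obtain ⟨hw1, hw2⟩ := hwin
    constructor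
    · rw [mul_div_assoc]; linarith
    · rw [mul_div_assoc]; linarith
  -- `BlockCondensation` at `(2A, K/2)` on the 8 translated states, transported back to `Ψ`
  have h13595 : ∀ τ₀ : Fin 3 → Fin 2, ENNReal.ofReal ((1 - η) * ((n + 1 : ℕ) : ℝ))
      ≤ ∑ S : Fin 3 → Fin (K / 2), cellOccupation (n + 1) L (fun x : EuclideanSpace ℝ (Fin 3) => ∑ τ : Fin 3 → Fin 2, (((Real.sqrt 8)⁻¹ : ℝ) : ℂ) * (if (∀ i : Fin 3, ⌊(K : ℝ) * x i / L⌋ = ((((((fun j : Fin 3 => (⟨2 * (S j : ℕ), by omega⟩ : Fin K)) + (fun i : Fin 3 => ((τ₀ i : ℕ) • (1 : Fin K)))) + (fun i : Fin 3 => ((τ i : ℕ) • (1 : Fin K)))) i : Fin K) : ℕ) : ℤ)) then ((((Real.sqrt ((L / (K : ℝ)) ^ 3))⁻¹ : ℝ) : ℂ)) else 0)) Ψ.ψ := by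
    intro τ₀
    obtain ⟨Ψt, hΨt⟩ := Ψ.exists_translate
      (∑ k : Fin 3, EuclideanSpace.single k (-(((τ₀ k : ℕ) : ℝ) * (L / (K : ℝ)))))
    have hEt : periodicEnergy v Ψt ≤ periodicGroundStateEnergy v (n + 1) L + δ := by
      rw [periodicEnergy_translate v Ψ _ hΨt]; exact hΨE
    have h1 := HΨ Ψt hEt (K / 2) hK'even hK'pos hwin'
    refine h1.trans (le_of_eq (Finset.sum_congr rfl (fun S _ => ?_)))
    rw [Kinematics.cellOccupation_congr (L := L)
      (fun y hy => Shift.bigblock_eq_on_cell (K := K) hL hKK hK2 S hy) Ψt.ψ]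
    rw [Covariance.cellOccupation_translate hL Ψ _ hΨt
      (φ := (fun x : EuclideanSpace ℝ (Fin 3) => ∑ τ : Fin 3 → Fin 2, (((Real.sqrt 8)⁻¹ : ℝ) : ℂ) * (if (∀ i : Fin 3, ⌊(K : ℝ) * x i / L⌋ % (K : ℤ) = (((((fun j : Fin 3 => (⟨2 * (S j : ℕ), by omega⟩ : Fin K)) + (fun i : Fin 3 => ((τ i : ℕ) • (1 : Fin K)))) i : Fin K) : ℕ) : ℤ)) then ((((Real.sqrt ((L / (K : ℝ)) ^ 3))⁻¹ : ℝ) : ℂ)) else 0)))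
      (fun y k => Shift.psuper_periodic (K := K) hL.ne' _ _ y k)]
    refine Kinematics.cellOccupation_congr (L := L) (fun y hy => ?_) Ψ.ψ
    beta_reduce
    rw [Shift.psuper_shift (K := K) hL.ne' hK2, Shift.psuper_eq_on_cell (K := K) hL hK _ _ hy]
  have hcorner : 8 * ENNReal.ofReal ((1 - η) * ((n + 1 : ℕ) : ℝ))
      ≤ ∑ c : Fin 3 → Fin K, cellOccupation (n + 1) L (fun x : EuclideanSpace ℝ (Fin 3) => ∑ τ : Fin 3 → Fin 2, (((Real.sqrt 8)⁻¹ : ℝ) : ℂ) * (if (∀ i : Fin 3, ⌊(K : ℝ) * x i / L⌋ = ((((c + (fun i : Fin 3 => ((τ i : ℕ) • (1 : Fin K)))) i : Fin K) : ℕ) : ℤ)) then ((((Real.sqrt ((L / (K : ℝ)) ^ 3))⁻¹ : ℝ) : ℂ)) else 0)) Ψ.ψ := by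
    calc 8 * ENNReal.ofReal ((1 - η) * ((n + 1 : ℕ) : ℝ))
        = ∑ τ₀ : Fin 3 → Fin 2, ENNReal.ofReal ((1 - η) * ((n + 1 : ℕ) : ℝ)) := by
          rw [Finset.sum_const, Finset.card_univ, Fintype.card_fun, Fintype.card_fin,
            Fintype.card_fin, nsmul_eq_mul]
          norm_num
      _ ≤ ∑ τ₀ : Fin 3 → Fin 2, ∑ S : Fin 3 → Fin (K / 2), cellOccupation (n + 1) L (fun x : EuclideanSpace ℝ (Fin 3) => ∑ τ : Fin 3 → Fin 2, (((Real.sqrt 8)⁻¹ : ℝ) : ℂ) * (if (∀ i : Fin 3, ⌊(K : ℝ) * x i / L⌋ = ((((((fun j : Fin 3 => (⟨2 * (S j : ℕ), by omega⟩ : Fin K)) + (fun i : Fin 3 => ((τ₀ i : ℕ) • (1 : Fin K)))) + (fun i : Fin 3 => ((τ i : ℕ) • (1 : Fin K)))) i : Fin K) : ℕ) : ℤ)) then ((((Real.sqrt ((L / (K : ℝ)) ^ 3))⁻¹ : ℝ) : ℂ)) else 0)) Ψ.ψ :=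
          Finset.sum_le_sum (fun τ₀ _ => h13595 τ₀)
      _ ≤ ∑ c : Fin 3 → Fin K, cellOccupation (n + 1) L (fun x : EuclideanSpace ℝ (Fin 3) => ∑ τ : Fin 3 → Fin 2, (((Real.sqrt 8)⁻¹ : ℝ) : ℂ) * (if (∀ i : Fin 3, ⌊(K : ℝ) * x i / L⌋ = ((((c + (fun i : Fin 3 => ((τ i : ℕ) • (1 : Fin K)))) i : Fin K) : ℕ) : ℤ)) then ((((Real.sqrt ((L / (K : ℝ)) ^ 3))⁻¹ : ℝ) : ℂ)) else 0)) Ψ.ψ :=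
          Shift.sum_corners_le (K := K) hKK hK2
            (fun c => cellOccupation (n + 1) L (fun x : EuclideanSpace ℝ (Fin 3) => ∑ τ : Fin 3 → Fin 2, (((Real.sqrt 8)⁻¹ : ℝ) : ℂ) * (if (∀ i : Fin 3, ⌊(K : ℝ) * x i / L⌋ = ((((c + (fun i : Fin 3 => ((τ i : ℕ) • (1 : Fin K)))) i : Fin K) : ℕ) : ℤ)) then ((((Real.sqrt ((L / (K : ℝ)) ^ 3))⁻¹ : ℝ) : ℂ)) else 0)) Ψ.ψ)
  -- super-block Cauchy–Schwarz, Bessel, and the f-sum identity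
  have hSB := SuperblockOcc.superblock_occupation (L := L) (K := K) (n := n) hΨc
  have hBes := Bessel.sum_cellOccupation_blockMode_le_card (L := L) (K := K) (Nat.succ_pos n) hK hL Ψ
  rw [FSum.fsum_occupation hK hL (fun j B => B + (Pi.single j (1 : Fin K) : Fin 3 → Fin K))
    (fun j B => Superblock.succ_spec j B) hΨc]
  beta_reduce
  generalize hX : (∑ j : Fin 3, ∑ B : Fin 3 → Fin K, cellOccupation (n + 1) L (fun x : EuclideanSpace ℝ (Fin 3) => (((Real.sqrt 2)⁻¹ : ℝ) : ℂ) * ((if (∀ i : Fin 3, ⌊(K : ℝ) * x i / L⌋ = (((B i : Fin K) : ℕ) : ℤ)) then ((((Real.sqrt ((L / (K : ℝ)) ^ 3))⁻¹ : ℝ) : ℂ)) else 0) - (if (∀ i : Fin 3, ⌊(K : ℝ) * x i / L⌋ = ((((B + (Pi.single j (1 : Fin K) : Fin 3 → Fin K)) i : Fin K) : ℕ) : ℤ)) then ((((Real.sqrt ((L / (K : ℝ)) ^ 3))⁻¹ : ℝ) : ℂ)) else 0))) Ψ.ψ) = X at hSB ⊢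
  generalize hY : (∑ c : Fin 3 → Fin K, cellOccupation (n + 1) L (fun x : EuclideanSpace ℝ (Fin 3) => ∑ τ : Fin 3 → Fin 2, (((Real.sqrt 8)⁻¹ : ℝ) : ℂ) * (if (∀ i : Fin 3, ⌊(K : ℝ) * x i / L⌋ = ((((c + (fun i : Fin 3 => ((τ i : ℕ) • (1 : Fin K)))) i : Fin K) : ℕ) : ℤ)) then ((((Real.sqrt ((L / (K : ℝ)) ^ 3))⁻¹ : ℝ) : ℂ)) else 0)) Ψ.ψ) = Y at hSB hcorner
  generalize hZ : (∑ B : Fin 3 → Fin K, cellOccupation (n + 1) L (fun x : EuclideanSpace ℝ (Fin 3) => if (∀ j : Fin 3, ⌊(K : ℝ) * x j / L⌋ = (((B j : Fin K) : ℕ) : ℤ)) then ((((Real.sqrt ((L / (K : ℝ)) ^ 3))⁻¹ : ℝ) : ℂ)) else 0) Ψ.ψ) = Z at hSB hBes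
  -- ENNReal bookkeeping
  have hn0 : (0 : ℝ) ≤ ((n + 1 : ℕ) : ℝ) := by positivity
  have hZ' : ENNReal.ofReal 6 * Z ≤ ENNReal.ofReal (6 * ((n + 1 : ℕ) : ℝ)) := by
    calc ENNReal.ofReal 6 * Z ≤ ENNReal.ofReal 6 * ((n + 1 : ℕ) : ℝ≥0∞) := by gcongr
      _ = ENNReal.ofReal (6 * ((n + 1 : ℕ) : ℝ)) := by
          rw [ENNReal.ofReal_mul (by norm_num), ENNReal.ofReal_natCast]
  by_cases hη1 : 1 ≤ η
  · calc X ≤ X + ENNReal.ofReal (3 / 4) * Y := le_self_add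
      _ ≤ ENNReal.ofReal (6 * ((n + 1 : ℕ) : ℝ)) := hSB.trans hZ'
      _ ≤ ENNReal.ofReal (6 * η * ((n + 1 : ℕ) : ℝ)) := ENNReal.ofReal_le_ofReal (by nlinarith)
  · push Not at hη1
    have hpos : 0 ≤ (1 - η) * ((n + 1 : ℕ) : ℝ) := mul_nonneg (by linarith) hn0
    have h6 : ENNReal.ofReal (6 * ((1 - η) * ((n + 1 : ℕ) : ℝ))) ≤ ENNReal.ofReal (3 / 4) * Y := by
      calc ENNReal.ofReal (6 * ((1 - η) * ((n + 1 : ℕ) : ℝ)))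
          = ENNReal.ofReal (3 / 4) * (8 * ENNReal.ofReal ((1 - η) * ((n + 1 : ℕ) : ℝ))) := by
            rw [show (8 : ℝ≥0∞) = ENNReal.ofReal 8 from (ENNReal.ofReal_ofNat 8).symm,
              ← ENNReal.ofReal_mul (by norm_num), ← ENNReal.ofReal_mul (by norm_num)]
            congr 1
            ring
        _ ≤ ENNReal.ofReal (3 / 4) * Y := by gcongr
    have hmain : X + ENNReal.ofReal (6 * ((1 - η) * ((n + 1 : ℕ) : ℝ))) ≤ ENNReal.ofReal (6 * ((n + 1 : ℕ) : ℝ)) :=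
      calc X + ENNReal.ofReal (6 * ((1 - η) * ((n + 1 : ℕ) : ℝ)))
          ≤ X + ENNReal.ofReal (3 / 4) * Y := by gcongr
        _ ≤ ENNReal.ofReal (6 * ((n + 1 : ℕ) : ℝ)) := hSB.trans hZ'
    calc X ≤ ENNReal.ofReal (6 * ((n + 1 : ℕ) : ℝ)) - ENNReal.ofReal (6 * ((1 - η) * ((n + 1 : ℕ) : ℝ))) :=
          ENNReal.le_sub_of_add_le_right ENNReal.ofReal_ne_top hmain
      _ = ENNReal.ofReal (6 * ((n + 1 : ℕ) : ℝ) - 6 * ((1 - η) * ((n + 1 : ℕ) : ℝ))) :=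
          (ENNReal.ofReal_sub _ (mul_nonneg (by norm_num) hpos)).symm
      _ = ENNReal.ofReal (6 * η * ((n + 1 : ℕ) : ℝ)) := by
          congr 1
          ring

end Summit.AtomisticToContinuum.BoseEinsteinCondensation.Theses.BlockLatticeFSum.SB
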